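import Mathlib.Algebra.Polynomial.Homogenize
import Mathlib.Algebra.Polynomial.Reverse
import Mathlib.Algebra.Polynomial.Inductions
import Mathlib.Algebra.Polynomial.Degree.Units
import Mathlib.RingTheory.Coprime.Lemmas
import Literature.NumberTheory.DiophantineGeometry.ProjectiveMorphismHeight
import HarnessLib

/-!
# Heights under a rational function `ℙ¹ → ℙ¹` given by a coprime pair `(p, q)`
# (Silverman AEC Thm. VIII.5.6 for `ℙ¹`, field-uniform form; [GenEll] Prop. 1.4 (i)+(iii) on `ℙ¹`)

Let `k` be a number field and `p, q ∈ k[X]` COPRIME polynomials with `max (deg p, deg q) = n`.  The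
rational function `φ = p/q : ℙ¹ → ℙ¹` is a morphism of degree `n`, and the height machine gives
`h(φ(x)) = n·h(x) + O(1)` on `ℙ¹(ℚ̄)`.  The tree's `exists_abs_logHeight_eval_sub_le_finrank`
(`ProjectiveMorphismHeight.lean`, Silverman VIII.5.6 in FIELD-UNIFORM form: the `O(1)` is
`≤ C·[K:ℚ]` with `C` depending on the map only) is stated for a morphism `ℙ^ι → ℙ^{ι'}` GIVEN a
Nullstellensatz certificate `Σ_j q_{ij}·p_j = X_i^{m+n}`.  This file CONSTRUCTS that certificate for
`ℙ¹` from `IsCoprime p q` and packages the result in the one-variable forms consumers use: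

* `isCoprime_reflect` — if `a·p + b·q = 1` and one of `p, q` has degree exactly `n`, the reflected
  pair `X^n p(1/X), X^n q(1/X)` is again coprime (no common zero at `∞`);
* `rename_swap_homogenize_reflect` — homogenising the reflected polynomial is homogenising and
  swapping the two variables;
* `exists_certificate_X_one` / `exists_certificate_X_zero` / `exists_certificate` — the two
  certificates `A·P + B·Q = X₁^{m+n}` (homogenise `a·p + b·q = 1`) and `A'·P + B'·Q = X₀^{m+n}`
  (the same for the reflected pair, then swap), padded to a common `m`, for
  `P = p.homogenize n`, `Q = q.homogenize n` (Mathlib `Polynomial.homogenize`);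
* `exists_abs_logHeight_homogenize_sub_le_finrank` — projective form: for all number fields
  `K ⊇ k` and `x : Fin 2 → K`, `|logHeight (P(x), Q(x)) − n·logHeight x| ≤ C·[K:ℚ]`;
* `exists_abs_logHeight_aeval_sub_le_finrank`, `exists_abs_logHeight₁_div_sub_le_finrank` — affine
  forms: `|logHeight (p(x), q(x)) − n·logHeight₁ x| ≤ C·[K:ℚ]` and
  `|logHeight₁ (p(x)/q(x)) − n·logHeight₁ x| ≤ C·[K:ℚ]` for `x : K` (at a zero of `q` both sides see
  the point `[1:0]`, whose height is `0 = logHeight₁ 0`, so no exception is needed);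
* `exists_mul_logHeight₁_le_add_finrank` — the one-sided "lower bound" shape
  `n·h_K(x) ≤ h_K(p(x)/q(x)) + C·[K:ℚ]` (and the upper one), as consumed by transfer lemmas for
  Vojta-type inequalities along self-maps of `ℙ¹`.

Classical (Silverman, *The Arithmetic of Elliptic Curves*, Thm. VIII.5.6; the `ℙ¹` case is also
[GenEll] Prop. 1.4 (i), (iii) for `X = ℙ¹`).  abc-iut cell: support brick for the GenEllTwo package
(stmt-ABC-19679: heights along the Belyi map `β = p/q` and the cusp-preserving maps `γ`); nothing here
bears on anything disputed.  Theorems only; no definitions, no named facts.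
-/

noncomputable section

open Polynomial

namespace Literature.NumberTheory.DiophantineGeometry

universe u

/-! ## Algebra: coprimality at infinity and the two Nullstellensatz certificates -/

section Algebra

variable {k : Type*} [Field k]

/-- `X` is coprime to any polynomial with nonzero constant coefficient (over a field):
`f = X·(f div X) + f(0)`. [cite: SilvermanAEC2009, Thm VIII.5.6 (proof)] -/
theorem isCoprime_X_of_coeff_zero_ne_zero {f : k[X]} (h : f.coeff 0 ≠ 0) : IsCoprime X f := by
  refine ⟨-(C (f.coeff 0)⁻¹ * divX f), C (f.coeff 0)⁻¹, ?_⟩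
  have hf := X_mul_divX_add f
  have hC : C (f.coeff 0)⁻¹ * C (f.coeff 0) = (1 : k[X]) := by
    rw [← C_mul, inv_mul_cancel₀ h, C_1]
  linear_combination (-C (f.coeff 0)⁻¹) * hf + hC

/-- If `p, q` are coprime, `deg p, deg q ≤ n`, and one of them has degree exactly `n`, then one of the
top coefficients `p_n, q_n` is nonzero (the pair has no common zero at `∞`).  (If, say, `deg p = n` but
`p = 0`, then `n = 0` and `q` is a unit.) [cite: SilvermanAEC2009, Thm VIII.5.6 (proof)] -/
theorem coeff_ne_zero_or_of_isCoprime {p q : k[X]} (hpq : IsCoprime p q) {n : ℕ}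
    (hn : p.natDegree = n ∨ q.natDegree = n) : p.coeff n ≠ 0 ∨ q.coeff n ≠ 0 := by
  rcases hn with hp | hq
  · by_cases hp0 : p = 0
    · subst hp0
      have hu : IsUnit q := isCoprime_zero_left.mp hpq
      have hq0 : q ≠ 0 := hu.ne_zero
      have hn0 : n = 0 := by simpa using hp.symm
      subst hn0
      right
      rw [← natDegree_eq_zero_of_isUnit hu]
      exact leadingCoeff_ne_zero.mpr hq0
    · left
      rw [← hp]
      exact leadingCoeff_ne_zero.mpr hp0
  · by_cases hq0 : q = 0
    · subst hq0
      have hu : IsUnit p := isCoprime_zero_right.mp hpq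
      have hp0 : p ≠ 0 := hu.ne_zero
      have hn0 : n = 0 := by simpa using hq.symm
      subst hn0
      left
      rw [← natDegree_eq_zero_of_isUnit hu]
      exact leadingCoeff_ne_zero.mpr hp0
    · right
      rw [← hq]
      exact leadingCoeff_ne_zero.mpr hq0

/-- Reflecting a Bézout identity: from `a·p + b·q = 1` with `deg a, deg b ≤ m`, `deg p, deg q ≤ n` one gets
`(X^m a(1/X))·(X^n p(1/X)) + (X^m b(1/X))·(X^n q(1/X)) = X^{m+n}`.
[cite: SilvermanAEC2009, Thm VIII.5.6 (proof)] -/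
theorem reflect_bezout {p q a b : k[X]} (hab : a * p + b * q = 1) {m n : ℕ}
    (ha : a.natDegree ≤ m) (hb : b.natDegree ≤ m) (hp : p.natDegree ≤ n) (hq : q.natDegree ≤ n) :
    reflect m a * reflect n p + reflect m b * reflect n q = X ^ (m + n) := by
  have h := congrArg (reflect (m + n)) hab
  rwa [reflect_add, reflect_mul a p ha hp, reflect_mul b q hb hq, reflect_one] at h

/-- **Coprimality at infinity.**  If `p, q ∈ k[X]` are coprime, `deg p, deg q ≤ n` and one of them has
degree exactly `n`, then the reflected pair `X^n p(1/X)`, `X^n q(1/X)` is coprime: reflecting a Bézout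
identity shows `X^{m+n} ∈ (p̃, q̃)`, and `X` is coprime to whichever of `p̃, q̃` has nonzero constant
term `p_n` resp. `q_n`. [cite: SilvermanAEC2009, Thm VIII.5.6 (proof)] -/
theorem isCoprime_reflect {p q : k[X]} (hpq : IsCoprime p q) {n : ℕ} (hp : p.natDegree ≤ n)
    (hq : q.natDegree ≤ n) (hn : p.natDegree = n ∨ q.natDegree = n) :
    IsCoprime (reflect n p) (reflect n q) := by
  obtain ⟨a, b, hab⟩ := hpq
  set m := max a.natDegree b.natDegree with hm
  have hX : reflect m a * reflect n p + reflect m b * reflect n q = X ^ (m + n) :=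
    reflect_bezout hab (le_max_left _ _) (le_max_right _ _) hp hq
  rcases coeff_ne_zero_or_of_isCoprime ⟨a, b, hab⟩ hn with hpn | hqn
  · -- `X^{m+n}` is coprime to `p̃`
    have h0 : (reflect n p).coeff 0 ≠ 0 := by
      rwa [coeff_reflect, revAt_zero]
    obtain ⟨c, d, hcd⟩ := (isCoprime_X_of_coeff_zero_ne_zero h0).pow_left (m := m + n)
    refine ⟨c * reflect m a + d, c * reflect m b, ?_⟩
    linear_combination hcd + c * hX
  · have h0 : (reflect n q).coeff 0 ≠ 0 := by
      rwa [coeff_reflect, revAt_zero]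
    obtain ⟨c, d, hcd⟩ := (isCoprime_X_of_coeff_zero_ne_zero h0).pow_left (m := m + n)
    refine ⟨c * reflect m a, c * reflect m b + d, ?_⟩
    linear_combination hcd + c * hX

/-- **Homogenising the reflected polynomial = homogenising and swapping the variables**:
`swap (homogenize (X^n p(1/X)) n) = homogenize p n` in `k[X₀, X₁]` (comparison of coefficients: the
coefficient of `X₀^i X₁^j`, `i + j = n`, is `p_i` on both sides).
[cite: SilvermanAEC2009, Thm VIII.5.6 (proof)] -/
theorem rename_swap_homogenize_reflect (p : k[X]) (n : ℕ) :
    MvPolynomial.rename (Equiv.swap (0 : Fin 2) 1) ((reflect n p).homogenize n) =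
      p.homogenize n := by
  classical
  ext d
  have hσ : (⇑(Equiv.swap (0 : Fin 2) 1) ∘ ⇑(Equiv.swap (0 : Fin 2) 1)) = id :=
    funext fun i => Equiv.swap_apply_self _ _ i
  have hd : (d.mapDomain (Equiv.swap (0 : Fin 2) 1)).mapDomain (Equiv.swap (0 : Fin 2) 1) = d := by
    rw [← Finsupp.mapDomain_comp, hσ, Finsupp.mapDomain_id]
  rw [← hd, MvPolynomial.coeff_rename_mapDomain _ (Equiv.injective _), hd, coeff_homogenize,
    coeff_homogenize, Finsupp.mapDomain_equiv_apply, Finsupp.mapDomain_equiv_apply,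
    Equiv.symm_swap, Equiv.swap_apply_left, Equiv.swap_apply_right, coeff_reflect]
  by_cases h : d 1 + d 0 = n
  · rw [if_pos h, if_pos (by omega), revAt_le (by omega)]
    congr 1
    omega
  · rw [if_neg h, if_neg (by omega)]

/-- **The certificate at `X₁`.**  If `a·p + b·q = 1`, then homogenising in degree `m + n`
(`m ≥ deg a, deg b`) gives `A·P + B·Q = X₁^{m+n}` with `A, B` forms of degree `m` and
`P = p.homogenize n`, `Q = q.homogenize n`. [cite: SilvermanAEC2009, Thm VIII.5.6 (proof)] -/
theorem exists_certificate_X_one {p q : k[X]} (hpq : IsCoprime p q) {n : ℕ} (hp : p.natDegree ≤ n)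
    (hq : q.natDegree ≤ n) :
    ∃ (m : ℕ) (A B : MvPolynomial (Fin 2) k), A.IsHomogeneous m ∧ B.IsHomogeneous m ∧
      A * p.homogenize n + B * q.homogenize n = MvPolynomial.X 1 ^ (m + n) := by
  obtain ⟨a, b, hab⟩ := hpq
  refine ⟨max a.natDegree b.natDegree, a.homogenize _, b.homogenize _,
    isHomogeneous_homogenize a, isHomogeneous_homogenize b, ?_⟩
  have h := congrArg (fun f : k[X] => f.homogenize (max a.natDegree b.natDegree + n)) hab
  rwa [homogenize_add, homogenize_mul a p (le_max_left _ _) hp,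
    homogenize_mul b q (le_max_right _ _) hq, homogenize_one] at h

/-- **The certificate at `X₀`.**  If `p, q` are coprime with `deg p, deg q ≤ n` and one of them of
degree exactly `n`, then `A'·P + B'·Q = X₀^{m+n}` for some forms `A', B'` of degree `m`
(certificate at `X₁` for the reflected pair, then swap the variables).
[cite: SilvermanAEC2009, Thm VIII.5.6 (proof)] -/
theorem exists_certificate_X_zero {p q : k[X]} (hpq : IsCoprime p q) {n : ℕ} (hp : p.natDegree ≤ n)
    (hq : q.natDegree ≤ n) (hn : p.natDegree = n ∨ q.natDegree = n) :
    ∃ (m : ℕ) (A B : MvPolynomial (Fin 2) k), A.IsHomogeneous m ∧ B.IsHomogeneous m ∧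
      A * p.homogenize n + B * q.homogenize n = MvPolynomial.X 0 ^ (m + n) := by
  obtain ⟨m, A, B, hA, hB, h⟩ := exists_certificate_X_one (n := n) (isCoprime_reflect hpq hp hq hn)
    (natDegree_reflect_le.trans (max_eq_left hp).le) (natDegree_reflect_le.trans (max_eq_left hq).le)
  refine ⟨m, MvPolynomial.rename (Equiv.swap (0 : Fin 2) 1) A,
    MvPolynomial.rename (Equiv.swap (0 : Fin 2) 1) B, hA.rename_isHomogeneous,
    hB.rename_isHomogeneous, ?_⟩
  have h' := congrArg (MvPolynomial.rename (Equiv.swap (0 : Fin 2) 1)) h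
  simp only [map_add, map_mul, map_pow, MvPolynomial.rename_X, rename_swap_homogenize_reflect,
    Equiv.swap_apply_right] at h'
  exact h'

/-- **The Nullstellensatz certificate of a coprime pair on `ℙ¹`**, in the shape consumed by
`exists_abs_logHeight_eval_sub_le_finrank`: forms `c_{ij}` of one common degree `m` with
`Σ_j c_{ij}·P_j = X_i^{m+n}` for `i = 0, 1`, where `P_0 = p.homogenize n`, `P_1 = q.homogenize n`
(the two certificates padded by powers of `X_i` to a common `m`).
[cite: SilvermanAEC2009, Thm VIII.5.6 (proof)] -/
theorem exists_certificate {p q : k[X]} (hpq : IsCoprime p q) {n : ℕ} (hp : p.natDegree ≤ n)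
    (hq : q.natDegree ≤ n) (hn : p.natDegree = n ∨ q.natDegree = n) :
    ∃ (m : ℕ) (c : Fin 2 × Fin 2 → MvPolynomial (Fin 2) k), (∀ a, (c a).IsHomogeneous m) ∧
      ∀ i, ∑ j, c (i, j) * ![p.homogenize n, q.homogenize n] j =
        MvPolynomial.X i ^ (m + n) := by
  obtain ⟨m₀, A₀, B₀, hA₀, hB₀, h₀⟩ := exists_certificate_X_zero hpq hp hq hn
  obtain ⟨m₁, A₁, B₁, hA₁, hB₁, h₁⟩ := exists_certificate_X_one hpq hp hq
  -- pad both certificates to the common degree `m₀ + m₁`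
  refine ⟨m₀ + m₁, fun a => ![![MvPolynomial.X 0 ^ m₁ * A₀, MvPolynomial.X 0 ^ m₁ * B₀],
    ![MvPolynomial.X 1 ^ m₀ * A₁, MvPolynomial.X 1 ^ m₀ * B₁]] a.1 a.2, ?_, ?_⟩
  · rintro ⟨i, j⟩
    fin_cases i <;> fin_cases j
    · simpa [add_comm] using (MvPolynomial.isHomogeneous_X_pow (0 : Fin 2) m₁).mul hA₀
    · simpa [add_comm] using (MvPolynomial.isHomogeneous_X_pow (0 : Fin 2) m₁).mul hB₀
    · simpa using (MvPolynomial.isHomogeneous_X_pow (1 : Fin 2) m₀).mul hA₁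
    · simpa using (MvPolynomial.isHomogeneous_X_pow (1 : Fin 2) m₀).mul hB₁
  · intro i
    fin_cases i
    · simp only [Fin.sum_univ_two, Fin.zero_eta, Fin.isValue, Matrix.cons_val_zero,
        Matrix.cons_val_one]
      calc MvPolynomial.X 0 ^ m₁ * A₀ * p.homogenize n + MvPolynomial.X 0 ^ m₁ * B₀ * q.homogenize n
          = MvPolynomial.X 0 ^ m₁ * (A₀ * p.homogenize n + B₀ * q.homogenize n) := by ring
        _ = MvPolynomial.X 0 ^ (m₀ + m₁ + n) := by rw [h₀]; ring
    · simp only [Fin.sum_univ_two, Fin.mk_one, Fin.isValue, Matrix.cons_val_zero,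
        Matrix.cons_val_one]
      calc MvPolynomial.X 1 ^ m₀ * A₁ * p.homogenize n + MvPolynomial.X 1 ^ m₀ * B₁ * q.homogenize n
          = MvPolynomial.X 1 ^ m₀ * (A₁ * p.homogenize n + B₁ * q.homogenize n) := by ring
        _ = MvPolynomial.X 1 ^ (m₀ + m₁ + n) := by rw [h₁]; ring

end Algebra

/-! ## Heights: the field-uniform estimates -/

section Heights

open MvPolynomial Height NumberField

variable {k : Type u} [Field k] [NumberField k]

/-- **Heights under `(p : q) : ℙ¹ → ℙ¹`, projective field-uniform form** (Silverman AEC Thm. VIII.5.6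
for `ℙ¹`): for coprime `p, q ∈ k[X]` with `deg p, deg q ≤ n` and one of them of degree `n`, there is
`C` such that for every number field `K ⊇ k` and every `x : Fin 2 → K`,
`|logHeight (P(x), Q(x)) − n·logHeight x| ≤ C·[K:ℚ]`, `P, Q` the degree-`n` homogenisations.
[cite: SilvermanAEC2009, Thm VIII.5.6] -/
theorem exists_abs_logHeight_homogenize_sub_le_finrank {p q : k[X]} (hpq : IsCoprime p q) {n : ℕ}
    (hp : p.natDegree ≤ n) (hq : q.natDegree ≤ n) (hn : p.natDegree = n ∨ q.natDegree = n) :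
    ∃ C : ℝ, ∀ (K : Type u) [Field K] [NumberField K] [Algebra k K] (x : Fin 2 → K),
      |logHeight (fun j => (map (algebraMap k K) (![p.homogenize n, q.homogenize n] j)).eval x) -
          n * logHeight x| ≤ C * Module.finrank ℚ K := by
  obtain ⟨m, c, hc, hcert⟩ := exists_certificate hpq hp hq hn
  have hP : ∀ j, (![p.homogenize n, q.homogenize n] j).IsHomogeneous n := by
    intro j
    fin_cases j
    · exact isHomogeneous_homogenize p
    · exact isHomogeneous_homogenize q
  exact exists_abs_logHeight_eval_sub_le_finrank _ hP c hc hcert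

omit [NumberField k] in
/-- Evaluating the base change of `p.homogenize n` at `(x, 1)` gives `p(x)`.
[cite: SilvermanAEC2009, Thm VIII.5.6 (proof)] -/
theorem eval_map_homogenize_cons_one {K : Type*} [Field K] [Algebra k K] (p : k[X]) {n : ℕ}
    (hp : p.natDegree ≤ n) (x : K) :
    (map (algebraMap k K) (p.homogenize n)).eval ![x, 1] = aeval x p := by
  rw [MvPolynomial.eval_map, eval₂_homogenize_of_eq_one hp _ _ (by simp), Polynomial.aeval_def]
  simp

/-- **Heights under `x ↦ (p(x) : q(x))`, affine field-uniform form**: for coprime `p, q ∈ k[X]` with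
`deg p, deg q ≤ n` and one of them of degree `n`, there is `C` such that for every number field
`K ⊇ k` and every `x ∈ K`, `|logHeight (p(x), q(x)) − n·logHeight₁ x| ≤ C·[K:ℚ]`.
[cite: SilvermanAEC2009, Thm VIII.5.6] -/
theorem exists_abs_logHeight_aeval_sub_le_finrank {p q : k[X]} (hpq : IsCoprime p q) {n : ℕ}
    (hp : p.natDegree ≤ n) (hq : q.natDegree ≤ n) (hn : p.natDegree = n ∨ q.natDegree = n) :
    ∃ C : ℝ, ∀ (K : Type u) [Field K] [NumberField K] [Algebra k K] (x : K),
      |logHeight ![aeval x p, aeval x q] - n * logHeight₁ x| ≤ C * Module.finrank ℚ K := by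
  obtain ⟨C, hC⟩ := exists_abs_logHeight_homogenize_sub_le_finrank hpq hp hq hn
  refine ⟨C, fun K _ _ _ x => ?_⟩
  have h := hC K ![x, 1]
  have hfun : (fun j => (map (algebraMap k K) (![p.homogenize n, q.homogenize n] j)).eval ![x, 1]) =
      ![aeval x p, aeval x q] := by
    funext j
    fin_cases j
    · simpa using eval_map_homogenize_cons_one p hp x
    · simpa using eval_map_homogenize_cons_one q hq x
  rwa [hfun, ← logHeight₁_eq_logHeight] at h

/-- **Heights under the rational function `p/q`, field-uniform form** (Silverman AEC Thm. VIII.5.6 on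
`ℙ¹`; [GenEll] Prop. 1.4 (i)+(iii) for `ℙ¹`): for coprime `p, q ∈ k[X]` with `deg p, deg q ≤ n` and
one of them of degree `n`, there is `C` with `|h_K(p(x)/q(x)) − n·h_K(x)| ≤ C·[K:ℚ]` for every number
field `K ⊇ k` and every `x ∈ K` (`h_K = logHeight₁`; at a zero of `q` the quotient is `0` and the
point `(p(x) : 0) = [1:0]` has height `0` as well, so the statement holds there verbatim).
[cite: SilvermanAEC2009, Thm VIII.5.6] -/
theorem exists_abs_logHeight₁_div_sub_le_finrank {p q : k[X]} (hpq : IsCoprime p q) {n : ℕ}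
    (hp : p.natDegree ≤ n) (hq : q.natDegree ≤ n) (hn : p.natDegree = n ∨ q.natDegree = n) :
    ∃ C : ℝ, ∀ (K : Type u) [Field K] [NumberField K] [Algebra k K] (x : K),
      |logHeight₁ (aeval x p / aeval x q) - n * logHeight₁ x| ≤ C * Module.finrank ℚ K := by
  obtain ⟨C, hC⟩ := exists_abs_logHeight_aeval_sub_le_finrank hpq hp hq hn
  refine ⟨C, fun K _ _ _ x => ?_⟩
  rw [logHeight₁_div_eq_logHeight]
  exact hC K x

/-- The same for a pair of EQUAL degree `n = deg p = deg q` (the shape of a Belyi map `β = p/q`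
noncritical at `∞`: `deg p = deg q`, `lead p ≠ lead q`). [cite: SilvermanAEC2009, Thm VIII.5.6] -/
theorem exists_abs_logHeight₁_div_sub_le_finrank_of_natDegree_eq {p q : k[X]} (hpq : IsCoprime p q)
    (hdeg : p.natDegree = q.natDegree) :
    ∃ C : ℝ, ∀ (K : Type u) [Field K] [NumberField K] [Algebra k K] (x : K),
      |logHeight₁ (aeval x p / aeval x q) - p.natDegree * logHeight₁ x| ≤ C * Module.finrank ℚ K :=
  exists_abs_logHeight₁_div_sub_le_finrank hpq le_rfl (le_of_eq hdeg.symm) (Or.inl rfl)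

/-- **One-sided forms** (the shape consumed by Vojta-transfer lemmas along `ℙ¹ → ℙ¹`): a single `C`
with BOTH `n·h_K(x) ≤ h_K(p(x)/q(x)) + C·[K:ℚ]` and `h_K(p(x)/q(x)) ≤ n·h_K(x) + C·[K:ℚ]` for all number
fields `K ⊇ k` and all `x ∈ K`. [cite: SilvermanAEC2009, Thm VIII.5.6] -/
theorem exists_mul_logHeight₁_le_add_finrank {p q : k[X]} (hpq : IsCoprime p q) {n : ℕ}
    (hp : p.natDegree ≤ n) (hq : q.natDegree ≤ n) (hn : p.natDegree = n ∨ q.natDegree = n) :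
    ∃ C : ℝ, ∀ (K : Type u) [Field K] [NumberField K] [Algebra k K] (x : K),
      n * logHeight₁ x ≤ logHeight₁ (aeval x p / aeval x q) + C * Module.finrank ℚ K ∧
        logHeight₁ (aeval x p / aeval x q) ≤ n * logHeight₁ x + C * Module.finrank ℚ K := by
  obtain ⟨C, hC⟩ := exists_abs_logHeight₁_div_sub_le_finrank hpq hp hq hn
  refine ⟨C, fun K _ _ _ x => ?_⟩
  have h := abs_le.mp (hC K x)
  constructor <;> linarith [h.1, h.2]

end Heights

end Literature.NumberTheory.DiophantineGeometry

end
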